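import Summits.Ventures.PercRepro.MSTheoremS

/-!
# The defect of a near-member determines it (Lemma U), part 1: the product helpers and case α

For a tight family `F`, a sign pattern `σ` (members with `σ t = true` are «agreement» members,
the others «disagreement» members) and a set `u`, the **required cells** of `u` at a member `t`
are `t ∩ v` and `tᶜ ∩ vᶜ` with `v = u` at agreement members and `v = uᶜ` at disagreement members.
The general mixed-cell lemma (`mem_or_compl_mem_of_tight`) says: if every required cell is a
difference of `F`, then `u` or `uᶜ` is a member. This file treats the situation **one defect
away** from that: all required cells lie in `F \\ F ∪ {e}` for a single non-difference `e`, and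
neither `u` nor `uᶜ` is a member. Then **`u` is determined by `(F, σ, e)`**
(`eq_of_cells_subset_insert`): with `M = Rstar F`, `N = Mᶜ`, evaluating at the member `M` shows
that `e` is `M ∩ u` or `N \ u`; in the first case `N ∩ u` is the union of the twin classes `q ⊆ N`
that are not differences or whose member `q ∪ M` is a disagreement member
(`mem_iff_of_inter_Rstar_eq`), in the second case `M ∩ u` is the union of the classes `q ⊆ M`
that are differences whose member `M \ q` is an agreement member
(`mem_iff_of_sdiff_Rstar_eq`, `MSTightDefectB.lean`) — in both cases because the alternative
would make `u` itself a member, by the product form `tight_eq_sups_of_tight` of Theorem S.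

This file: the membership form of the product structure (`union_sdiff_mem_of_tight`), the
twin-closed parts of differences, and case α. `MSTightDefectB.lean` adds case β and the
assembly `eq_of_cells_subset_insert` (Lemma U of proofs/MINE1-theoremS.md, gen 8 addendum): it
settles flavour (i) of the «two pairs of the third type» regime of the coloured Marica–Schönheim
statement — a second pair would have to reuse the same defect and hence coincide with the first.
-/

namespace PercRepro.MSTight

open Finset
open scoped FinsetFamily symmDiff

variable {α : Type*} [DecidableEq α]

/-- The empty set is a difference of a nonempty family. -/
theorem empty_mem_diffs_of_nonempty {F : Finset (Finset α)} (hne : F.Nonempty) :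
    (∅ : Finset α) ∈ F \\ F := by
  obtain ⟨A, hA⟩ := hne
  exact mem_diffs.2 ⟨A, hA, A, hA, Finset.sdiff_self A⟩

/-- A non-difference of a nonempty family is nonempty. -/
theorem ne_empty_of_notMem_diffs {F : Finset (Finset α)} (hne : F.Nonempty) {e : Finset α}
    (he : e ∉ F \\ F) : e ≠ ∅ := by
  rintro rfl
  exact he (empty_mem_diffs_of_nonempty hne)

variable [Fintype α]

/-- The two required (agreement) cells of `v` at `t` lie in `D`. -/
abbrev Cells (D : Finset (Finset α)) (t v : Finset α) : Prop :=
  t ∩ v ∈ D ∧ (Finset.univ \ t) ∩ (Finset.univ \ v) ∈ D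

section Product

/-- A twin-closed part of a difference is a difference. -/
theorem inter_mem_diffs_of_twinClosed {F : Finset (Finset α)} (hF : Tight F) {Z W : Finset α}
    (hZ : Z ∈ F \\ F) (hW : TwinClosed F W) : Z ∩ W ∈ F \\ F := by
  rw [diffs_eq_flip_of_tight hF] at hZ ⊢
  exact mem_flip_of_subset_of_twinClosed (dichotomy_of_tight hF) hZ inter_subset_left
    ((twinClosed_of_mem_flip hZ).inter hW)

/-- Removing a twin-closed set from a difference gives a difference. -/
theorem sdiff_mem_diffs_of_twinClosed {F : Finset (Finset α)} (hF : Tight F) {Z W : Finset α}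
    (hZ : Z ∈ F \\ F) (hW : TwinClosed F W) : Z \ W ∈ F \\ F := by
  rw [diffs_eq_flip_of_tight hF] at hZ ⊢
  exact mem_flip_of_subset_of_twinClosed (dichotomy_of_tight hF) hZ sdiff_subset
    ((twinClosed_of_mem_flip hZ).sdiff hW)

/-- A twin-closed subset of a difference is a difference. -/
theorem mem_diffs_of_subset_of_twinClosed {F : Finset (Finset α)} (hF : Tight F) {Z W : Finset α}
    (hZ : Z ∈ F \\ F) (hW : W ⊆ Z) (htc : TwinClosed F W) : W ∈ F \\ F := by
  rw [diffs_eq_flip_of_tight hF] at hZ ⊢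
  exact mem_flip_of_subset_of_twinClosed (dichotomy_of_tight hF) hZ hW htc

/-- **The product form, membership version**: a difference inside `Mᶜ` together with the
complement in `M` of a difference inside `M` form a member. -/
theorem union_sdiff_mem_of_tight {F : Finset (Finset α)} (hF : Tight F) {x y : Finset α}
    (hx : x ∈ F \\ F) (hxN : x ⊆ Finset.univ \ Rstar F) (hy : y ∈ F \\ F) (hyM : y ⊆ Rstar F) :
    x ∪ (Rstar F \ y) ∈ F := by
  rw [diffs_eq_flip_of_tight hF] at hx hy
  have : x ∪ (Rstar F \ y) ∈ within (flip (Rstar F) F) (Finset.univ \ Rstar F) ⊻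
      complWithin (Rstar F) (within (flip (Rstar F) F) (Rstar F)) :=
    mem_sups.2 ⟨x, mem_within.2 ⟨hx, hxN⟩, Rstar F \ y,
      mem_complWithin.2 ⟨y, mem_within.2 ⟨hy, hyM⟩, rfl⟩, sup_eq_union⟩
  rwa [← tight_eq_sups_of_tight hF] at this

end Product

section LemmaU

/-- **Case α.** If `σ (Rstar F) = true` and the defect is `Rstar F ∩ u`, then for `p ∉ Rstar F`:
`p ∈ u` iff the class of `p` is not a difference or its member `cls ∪ Rstar F` is a disagreement
member. -/
theorem mem_iff_of_inter_Rstar_eq {F : Finset (Finset α)} (hF : Tight F) (hne : F.Nonempty)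
    (σ : Finset α → Bool) {e : Finset α} (he : e ∉ F \\ F) {u : Finset α} (hu : u ∉ F)
    (h : ∀ t ∈ F, Cells (insert e (F \\ F)) t (if σ t = true then u else Finset.univ \ u))
    (hσ : σ (Rstar F) = true) (hbe : Rstar F ∩ u = e) {p : α} (hp : p ∉ Rstar F) :
    p ∈ u ↔ ¬ (cls F p ∈ F \\ F ∧ σ (cls F p ∪ Rstar F) = true) := by
  set M := Rstar F with hM
  set N := Finset.univ \ M with hN
  set D := F \\ F with hD
  have hdich := dichotomy_of_tight hF
  have hMtc : TwinClosed F M := twinClosed_Rstar F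
  have hMF : M ∈ F := Rstar_mem_of_dichotomy hdich hne
  have hene : e ≠ ∅ := ne_empty_of_notMem_diffs hne he
  have heM : e ⊆ M := hbe ▸ inter_subset_left
  -- the second cell at `M`: `N \ u ∈ D`
  have hNa : N \ u ∈ D := by
    have := (h M hMF).2
    rw [hσ] at this
    simp only [if_true] at this
    rcases mem_insert.1 this with h1 | h1
    · exfalso
      apply hene
      rw [eq_empty_iff_forall_notMem]
      intro x hx
      have h2 := heM hx
      rw [← h1] at hx
      exact (mem_sdiff.1 (mem_inter.1 hx).1).2 h2
    · have e1 : (Finset.univ \ M) ∩ (Finset.univ \ u) = N \ u := by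
        ext x; simp [hN]
      rwa [e1] at h1
  have hq : cls F p ⊆ N := by
    intro x hx
    rw [hN, mem_sdiff]
    exact ⟨mem_univ _, fun hxM => hp (hMtc x p (mem_cls.1 hx).symm hxM)⟩
  have hqtc : TwinClosed F (cls F p) := twinClosed_cls F p
  by_cases hqD : cls F p ∈ D
  · -- the member `q ∪ M`
    have htF : cls F p ∪ M ∈ F := by
      have := union_sdiff_mem_of_tight hF hqD hq (empty_mem_diffs_of_nonempty hne)
        (empty_subset _)
      rwa [sdiff_empty] at this
    have hqM : Disjoint (cls F p) M := disjoint_cls_of_twinClosed_of_notMem hMtc hp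
    by_cases hσt : σ (cls F p ∪ M) = true
    · -- agreement member: the cell `(q ∩ u) ∪ e` must be the defect
      refine ⟨fun hpu _ => ?_, fun h' => absurd ⟨hqD, hσt⟩ h'⟩
      have hc := (h _ htF).1
      rw [if_pos hσt] at hc
      have e1 : (cls F p ∪ M) ∩ u = (cls F p ∩ u) ∪ e := by
        rw [← hbe]; ext x; simp only [mem_inter, mem_union]; tauto
      rw [e1] at hc
      rcases mem_insert.1 hc with h1 | h1
      · -- `q ∩ u ⊆ e ⊆ M` forces `q ∩ u = ∅`
        have : p ∈ (cls F p ∩ u) ∪ e := mem_union.2 (Or.inl (mem_inter.2 ⟨self_mem_cls F p, hpu⟩))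
        rw [h1] at this
        exact hp (heM this)
      · -- its `M`-part is `e ∈ D`
        have := inter_mem_diffs_of_twinClosed hF h1 hMtc
        have e2 : (cls F p ∩ u ∪ e) ∩ M = e := by
          ext x
          simp only [mem_inter, mem_union]
          constructor
          · rintro ⟨⟨hxq, _⟩ | hxe, hxM⟩
            · exact absurd hxM (disjoint_left.1 hqM hxq)
            · exact hxe
          · intro hxe; exact ⟨Or.inr hxe, heM hxe⟩
        rw [e2] at this
        exact he this
    · -- disagreement member: the cells of `uᶜ`
      have hσf : σ (cls F p ∪ M) = false := by simpa using hσt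
      refine ⟨fun _ h' => hσt h'.2, fun _ => ?_⟩
      by_contra hpu
      have hc := h _ htF
      rw [if_neg hσt] at hc
      obtain ⟨hc1, hc2⟩ := hc
      -- first cell `(q \ u) ∪ (M \ e)`, second cell `(N ∩ u) \ q`
      have e1 : (cls F p ∪ M) ∩ (Finset.univ \ u) = (cls F p \ u) ∪ (M \ e) := by
        rw [← hbe]; ext x; simp only [mem_inter, mem_union, mem_sdiff, mem_univ, true_and]
        constructor
        · rintro ⟨hxq | hxM, hxu⟩
          · exact Or.inl ⟨hxq, hxu⟩
          · exact Or.inr ⟨hxM, fun h' => hxu h'.2⟩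
        · rintro (⟨hxq, hxu⟩ | ⟨hxM, hxe⟩)
          · exact ⟨Or.inl hxq, hxu⟩
          · exact ⟨Or.inr hxM, fun hxu => hxe ⟨hxM, hxu⟩⟩
      have e2 : (Finset.univ \ (cls F p ∪ M)) ∩ u = (N ∩ u) \ cls F p := by
        ext x; simp only [mem_inter, mem_sdiff, mem_union, mem_univ, true_and, hN]; tauto
      rw [e1] at hc1
      rw [Finset.sdiff_sdiff_eq_self (subset_univ u), e2] at hc2
      have hc1D : (cls F p \ u) ∪ (M \ e) ∈ D := by
        rcases mem_insert.1 hc1 with h1 | h1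
        · exfalso
          -- `M \ e ⊆ e` forces `e = M`, then `q \ u ⊆ e` forces `q \ u = ∅`, so the cell is `∅`
          have hMe : M \ e = ∅ := by
            rw [sdiff_eq_empty_iff_subset]
            intro x hxM
            by_contra hxe
            have : x ∈ (cls F p \ u) ∪ (M \ e) := mem_union.2 (Or.inr (mem_sdiff.2 ⟨hxM, hxe⟩))
            rw [h1] at this
            exact hxe this
          have hqu : cls F p \ u = ∅ := by
            rw [sdiff_eq_empty_iff_subset]
            intro x hxq
            by_contra hxu
            have : x ∈ (cls F p \ u) ∪ (M \ e) := mem_union.2 (Or.inl (mem_sdiff.2 ⟨hxq, hxu⟩))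
            rw [h1] at this
            exact (disjoint_left.1 hqM hxq) (heM this)
          rw [hMe, hqu, union_empty] at h1
          exact hene h1.symm
        · exact h1
      have hc2D : (N ∩ u) \ cls F p ∈ D := by
        rcases mem_insert.1 hc2 with h1 | h1
        · exfalso
          -- a subset of `N` cannot be the nonempty `e ⊆ M`
          obtain ⟨x, hx⟩ := nonempty_iff_ne_empty.2 hene
          have hxM := heM hx
          rw [← h1] at hx
          exact (mem_sdiff.1 (mem_inter.1 (mem_sdiff.1 hx).1).1).2 hxM
        · exact h1
      have hNtc : TwinClosed F N := (twinClosed_univ F).sdiff hMtc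
      -- the `N`-part of the first cell is `q \ u ∈ D`, twin-closed and containing `p`
      have hquD : cls F p \ u ∈ D := by
        have := inter_mem_diffs_of_twinClosed hF hc1D hNtc
        have e3 : ((cls F p \ u) ∪ (M \ e)) ∩ N = cls F p \ u := by
          ext x
          simp only [mem_inter, mem_union, mem_sdiff, hN, mem_univ, true_and]
          constructor
          · rintro ⟨⟨hxq, hxu⟩ | ⟨hxM, _⟩, hxM'⟩
            · exact ⟨hxq, hxu⟩
            · exact absurd hxM hxM'
          · rintro ⟨hxq, hxu⟩
            exact ⟨Or.inl ⟨hxq, hxu⟩, disjoint_left.1 hqM hxq⟩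
        rwa [e3] at this
      have hqu : Disjoint (cls F p) u := by
        have hsub : cls F p ⊆ cls F p \ u :=
          cls_subset_of_twinClosed (twinClosed_of_mem_diffs hquD)
            (mem_sdiff.2 ⟨self_mem_cls F p, hpu⟩)
        exact disjoint_left.2 fun x hx hxu => (mem_sdiff.1 (hsub hx)).2 hxu
      -- the `M`-part of the first cell is `M \ e ∈ D`
      have hMeD : M \ e ∈ D := by
        have := inter_mem_diffs_of_twinClosed hF hc1D hMtc
        have e3 : ((cls F p \ u) ∪ (M \ e)) ∩ M = M \ e := by
          ext x
          simp only [mem_inter, mem_union, mem_sdiff]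
          constructor
          · rintro ⟨⟨hxq, _⟩ | ⟨hxM, hxe⟩, hxM'⟩
            · exact absurd hxM' (disjoint_left.1 hqM hxq)
            · exact ⟨hxM, hxe⟩
          · rintro ⟨hxM, hxe⟩
            exact ⟨Or.inr ⟨hxM, hxe⟩, hxM⟩
        rwa [e3] at this
      -- the second cell is `N ∩ u ∈ D`
      have hNuD : N ∩ u ∈ D := by
        have e3 : (N ∩ u) \ cls F p = N ∩ u := by
          rw [sdiff_eq_self_of_disjoint]
          exact disjoint_left.2 fun x hx hxq => disjoint_left.1 hqu hxq (mem_inter.1 hx).2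
        rwa [e3] at hc2D
      -- hence `u = (N ∩ u) ∪ (M \ (M \ e))` is a member
      have hmem := union_sdiff_mem_of_tight hF hNuD inter_subset_left hMeD sdiff_subset
      rw [Finset.sdiff_sdiff_eq_self heM] at hmem
      have e4 : N ∩ u ∪ e = u := by
        rw [← hbe]
        ext x
        simp only [mem_union, mem_inter, hN, mem_sdiff, mem_univ, true_and]
        constructor
        · rintro (⟨_, hxu⟩ | ⟨_, hxu⟩) <;> exact hxu
        · intro hxu
          by_cases hxM : x ∈ M
          · exact Or.inr ⟨hxM, hxu⟩
          · exact Or.inl ⟨hxM, hxu⟩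
      rw [e4] at hmem
      exact hu hmem
  · -- `q ∉ D`: then `p ∈ u`, else `q ⊆ N \ u ∈ D`
    refine ⟨fun _ h' => hqD h'.1, fun _ => ?_⟩
    by_contra hpu
    have hpNu : p ∈ N \ u := mem_sdiff.2 ⟨mem_sdiff.2 ⟨mem_univ _, hp⟩, hpu⟩
    exact hqD (mem_diffs_of_subset_of_twinClosed hF hNa
      (cls_subset_of_twinClosed (twinClosed_of_mem_diffs hNa) hpNu) hqtc)

end LemmaU

end PercRepro.MSTight
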